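import Summits.CriticalPhenomena.Ising3DConformalLimit.Theses.FKParityRobustness
import Summits.CriticalPhenomena.Ising3DConformalLimit.Theses.IsingEuclidUpgrade
import Literature.Probability.LatticeModels.CriticalUrsellFourSign
import Literature.Probability.LatticeModels.HighDimPointwiseTriviality
import Literature.Probability.LatticeModels.PointwiseScalingLimitScale

/-!
# Disproof of `JoinForcesU4` (stmt-CriticalPhenomena-14627) — findings

Crux (route FKParityRobustness, rank 6, the BRIDGE of the rev-4 spine), verbatim:
`IndependentStrandsJoin → ∀ ρ S, (∀ δ ∈ Ioc 0 1, 0 < ρ δ) →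
  HasPointwiseScalingLimit (criticalCorr 3) ρ S → IsNondegenerateTwoPoint S → HasNontrivialU4 S`,
i.e. `IndependentStrandsJoin → NonGaussianLimit` with `NonGaussianLimit` = item 0636 inlined
(`crux_iff`, `conclusion_iff_item0636` : both `Iff.rfl`).

**VERDICT (cdisprove, cycle 1): NOT REFUTED — the statement resists, and resists for a structural
reason that is itself a theorem below.**  `¬ JoinForcesU4 ↔ IndependentStrandsJoin ∧ ¬ NonGaussianLimit`
(`not_crux_iff`): a refutation must (i) PROVE the rank-2 crux `IndependentStrandsJoin` (two independent
critical high-temperature strands on `ℤ³` meet with probability bounded below — open, predicted true,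
2·D_HT − 3 = 0.47) and (ii) EXHIBIT a non-degenerate pointwise scaling limit of the critical Ising₃
correlators with `U₄ ≡ 0` (`not_crux_imp_gaussianLimit`), i.e. settle the 3D non-triviality problem in
the direction every piece of evidence contradicts (Aizenman 1982; ADC 2021 settles `d = 4` as Gaussian;
`d = 3` open, ICM 2022 §6.4/§8.4). Worse for the refuter: by §B the bridge FOLLOWS from two
dimension-free, provable-now supports (`crux_of_supports`, with the third support `FarMergingGivesU4`
= item 4471 PROVED HERE, `farMergingGivesU4_holds`), so `¬ JoinForcesU4` would refute a finite-graph
identity of Aizenman type (`StrandsJoinBound`, exact-checked on 6 graphs × 5 temperatures by the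
one-shot refuter, evidence `strands_join_check.txt`) or the box → `ℤ³` limit glue
(`LatticeBoundFromStrands`): `not_crux_imp_not_support`. CONCURRING EVIDENCE (05:0x–05:4xZ): the crux
ideators' sketches in this directory (`SketchIdeator3.lean`, `SketchIdeatorK2.lean`: `joinForcesU4_holds :
JoinForcesU4` with `strandsJoinBound_holds`, `latticeBoundFromStrands_holds`, `farMergingGivesU4_holds`, no
`sorry` by inspection; `CandidateProof_JoinForcesU4.lean`) PROVE the bridge outright pending a prover's landing —
the disprover concurs: the item will close `proved`, not `refuted`.

## Index (all `theorem`s sorry-free unless marked NEAR-MISS)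
* §0 READ-BACK: `crux_iff`, `conclusion_iff_item0636` (the inlined conclusion IS the decl
  `IsingEuclidUpgrade.IsingEuclidUpgradeR4NonGaussian` of item 0636, definitionally), `crux_of_item0636`
  (0636 alone closes the bridge: `fun h _ => h`), `crux_of_not_strandsJoin` (the bridge is VACUOUSLY true
  if K1 is refuted), `not_crux_iff`, `not_crux_imp_gaussianLimit` (census of what a refutation must be).
* §A LOAD-BEARING ANALYSIS (one hypothesis dropped at a time; "any proof must use H"):
  - `withoutNondegeneracy_iff_not_strandsJoin` — drop `IsNondegenerateTwoPoint`: the bridge becomes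
    EQUIVALENT TO `¬ IndependentStrandsJoin` (witness `ρ δ = δ`, the zero family is a genuine pointwise
    limit of `criticalCorr 3`); so non-degeneracy is load-bearing unless K1 is false.
  - `withoutLimit_iff_not_strandsJoin` — drop the lattice clause `HasPointwiseScalingLimit …`: again
    equivalent to `¬ IndependentStrandsJoin` (witness: the Wick family `S₂ ≡ 1, S₄ ≡ 3`).
  - `iff_withoutPositivity` — drop `0 < ρ` on `(0,1]`: NOTHING changes (cosmetic hypothesis; odd critical
    correlators vanish and `S₂ > 0` forces `ρ ≠ 0` eventually). A prover may ignore `hρ`.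
  - `withoutStrandsJoin_iff_item0636` — drop the antecedent: the bridge becomes item 0636 itself (open).
* §B WHY IT RESISTS — the support chain, kernel-checked: `farMergingGivesU4_holds : FarMergingGivesU4`
  (item 4471, NEW, sorry-free; candidate proof attached to that item for a prover to land),
  `crux_of_supports : StrandsJoinBound → LatticeBoundFromStrands → JoinForcesU4`,
  `not_crux_imp_not_support : ¬ JoinForcesU4 → ¬ StrandsJoinBound ∨ ¬ LatticeBoundFromStrands`.
* §C WHAT THE CHAIN REALLY DELIVERS: `ray_bound_of_tetraLatticeBound` / `ray_bound_of_supports` — from the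
  tetrahedral lattice bound (K1 + the two supports) one gets, for EVERY non-degenerate pointwise limit and
  EVERY scale `s > 0`, `U₄^S(s•A) ≤ −c·S₂(s a₀,s a₁)·S₂(s a₂,s a₃) < 0` on the whole ray of regular
  tetrahedra (mesh `δ_l = s/l`, exact approximation `latticeApprox_dilate_siteVec`; no scale covariance
  used) — strictly more than clause (iii) asks; `conclusion_of_tetraLatticeBoundIO` — PLANNER NOTE: K1 may be
  weakened to its limsup-in-`l` form (the lattice bound along SOME sequence of scales suffices: 4471 uses
  only infinitely many dilations and the glue is scale-by-scale).
* §C.4 STRENGTHENING REFUTED IN LEAN: `not_loopAizenmanAllT` — `StrandsJoinBound` rewritten through the HT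
  expansion as the polynomial inequality `Z^Q Z⁰ − ΣZZ ≤ −2·JointSum_t` is FALSE for a free weight `t ≥ 0`
  (C4 = `cycleGraph 4`, `t = 2`: `−128 ≤ −192` fails; threshold `t = √2`): `tanh β ≤ 1` is load-bearing, no
  all-`t` bijective/XOR proof exists (tightness offered by card iterated-oddpart-pushforward, certified here).
* §D DIMENSION SHARPNESS (barrier IsingTrivialityFromDimensionFour, as a theorem): `FarMergingAt d`,
  `farMerging_gives_U4` (item 4471 holds in EVERY `d`, proof dimension-free), and
  `not_farMergingAt_of_exists_limit` — for `d ≥ 5` far merging is IMPOSSIBLE once a non-degenerate limit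
  exists (tree theorem `limitConnectedFour_eq_zero_of_hasPointwiseScalingLimit_holds`); since
  StrandsJoinBound and the glue are dimension-uniform, the `d ≥ 5` analogue of the spine fails exactly at
  K1_d: any proof of K1 must use `d < 4`.
* TARGETS: none yet (no line picked; `payload.targets = []`).
* NEAR-MISSES: none in Lean — the residue is exactly K1 ∧ (0636 false), two open problems.
-/

noncomputable section

namespace Summit.CriticalPhenomena.Ising3DConformalLimit.Cruxes.JoinForcesU4.Disproof

open Literature.Probability.LatticeModels Filter Set
open scoped Topology
open Summit.CriticalPhenomena.Ising3DConformalLimit.Theses.FKParityRobustness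

/-! ## §0 Read-back -/

/-- The crux, by name. -/
abbrev Crux : Prop :=
  Summit.CriticalPhenomena.Ising3DConformalLimit.Theses.FKParityRobustness.JoinForcesU4

/-- The antecedent K1 (rank-2 crux `IndependentStrandsJoin`, item 14625), by name. -/
abbrev StrandsJoin : Prop :=
  Summit.CriticalPhenomena.Ising3DConformalLimit.Theses.FKParityRobustness.IndependentStrandsJoin

/-- The consequent (item 0636 `NonGaussianLimit`, inlined verbatim in the crux). -/
abbrev Conclusion : Prop :=
  ∀ (ρ : ℝ → ℝ) (S : CorrFamily 3), (∀ δ ∈ Set.Ioc (0:ℝ) 1, 0 < ρ δ) →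
    HasPointwiseScalingLimit (criticalCorr 3) ρ S → IsNondegenerateTwoPoint S → HasNontrivialU4 S

/-- Unfolding of the crux (definitional): the bridge is `K1 → item 0636`. -/
theorem crux_iff : Crux ↔ (StrandsJoin → Conclusion) := Iff.rfl

/-- The inlined conclusion is VERBATIM the route support `NonGaussianLimit` (item 0636) … -/
theorem conclusion_iff_nonGaussianLimit : Conclusion ↔ NonGaussianLimit := Iff.rfl

/-- … and VERBATIM the crux decl of item 0636 in the route `IsingEuclidUpgrade` (which has its own
standing disprover and a 1000-line `Cruxes/IsingEuclidUpgradeR4NonGaussian/Disproof.lean`): the two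
items are definitionally one statement. -/
theorem conclusion_iff_item0636 :
    Conclusion ↔ Summit.CriticalPhenomena.Ising3DConformalLimit.Theses.IsingEuclidUpgrade.IsingEuclidUpgradeR4NonGaussian :=
  Iff.rfl

/-- Item 0636 alone closes the bridge (the antecedent is then unused). -/
theorem crux_of_item0636 (h : Conclusion) : Crux := fun _ => h

/-- The bridge is VACUOUSLY true if K1 is refuted: a refuter of `JoinForcesU4` must first PROVE K1. -/
theorem crux_of_not_strandsJoin (h : ¬ StrandsJoin) : Crux := fun hK => absurd hK h

/-- Shape of the negation: `¬ Crux ↔ K1 ∧ ¬ 0636`. -/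
theorem not_crux_iff : ¬ Crux ↔ StrandsJoin ∧ ¬ Conclusion := by
  rw [crux_iff, Classical.not_imp]

/-- **Census of what a refutation must be.** `¬ JoinForcesU4` yields K1 AND a renormalisation `ρ > 0`
with a non-degenerate pointwise scaling limit `S` of the critical Ising₃ correlators whose connected
four-point function vanishes at every non-coincident quadruple — a Gaussian critical Ising₃. -/
theorem not_crux_imp_gaussianLimit (h : ¬ Crux) :
    StrandsJoin ∧ ∃ (ρ : ℝ → ℝ) (S : CorrFamily 3), (∀ δ ∈ Set.Ioc (0:ℝ) 1, 0 < ρ δ) ∧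
      HasPointwiseScalingLimit (criticalCorr 3) ρ S ∧ IsNondegenerateTwoPoint S ∧
      ∀ x ∈ NonCoincident 3 4, limitConnectedFour S x = 0 := by
  obtain ⟨hK, hN⟩ := not_crux_iff.1 h
  refine ⟨hK, ?_⟩
  simp only [Conclusion, not_forall, exists_prop] at hN
  obtain ⟨ρ, S, hρ, hlim, hnd, hU⟩ := hN
  refine ⟨ρ, S, hρ, hlim, hnd, fun x hx => ?_⟩
  by_contra hne
  exact hU ⟨x, hx, hne⟩

/-! ## §A Load-bearing analysis -/

/-- The bridge with `IsNondegenerateTwoPoint` DROPPED from its conclusion. -/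
def CruxWithoutNondegeneracy : Prop :=
  StrandsJoin → ∀ (ρ : ℝ → ℝ) (S : CorrFamily 3), (∀ δ ∈ Set.Ioc (0:ℝ) 1, 0 < ρ δ) →
    HasPointwiseScalingLimit (criticalCorr 3) ρ S → HasNontrivialU4 S

/-- The zero family (with the correct constant `⟨1⟩ = criticalCorr 3 0 _` at `n = 0`). -/
def zeroFamily : CorrFamily 3 := fun n _ =>
  if n = 0 then criticalCorr 3 0 (fun _ => 0) else 0

/-- `ρ δ = δ` renormalises the critical correlators to the zero family: a GENUINE pointwise scaling
limit of `criticalCorr 3` (`|⟨∏σ⟩| ≤ 1` by `abs_criticalCorr_le_one`, so `|δⁿ⟨∏σ⟩| ≤ δ → 0`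
uniformly for `n ≥ 1`; `n = 0` is a constant). [folklore] -/
theorem hasPointwiseScalingLimit_zeroFamily :
    HasPointwiseScalingLimit (criticalCorr 3) (fun δ => δ) zeroFamily := by
  intro n
  rcases Nat.eq_zero_or_pos n with rfl | hn
  · refine TendstoUniformlyOn.tendstoLocallyUniformlyOn (Metric.tendstoUniformlyOn_iff.2 ?_)
    intro ε hε
    refine Filter.Eventually.of_forall fun δ x _ => ?_
    have hx : (fun i : Fin 0 => latticeApprox δ (x i)) = fun _ => (0 : Site 3) :=
      funext fun i => i.elim0
    rw [rescaledCorrelator_apply, hx]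
    simp [zeroFamily, hε]
  · refine TendstoUniformlyOn.tendstoLocallyUniformlyOn (Metric.tendstoUniformlyOn_iff.2 ?_)
    intro ε hε
    have hm : Set.Ioo (0:ℝ) (min 1 ε) ∈ 𝓝[>] (0:ℝ) := Ioo_mem_nhdsGT (lt_min one_pos hε)
    filter_upwards [hm] with δ hδ x _
    have hn0 : n ≠ 0 := hn.ne'
    simp only [zeroFamily, if_neg hn0, rescaledCorrelator_apply, Real.dist_eq, zero_sub, abs_neg, abs_mul,
      abs_pow, abs_of_pos hδ.1]
    have h1 : |criticalCorr 3 n fun i => latticeApprox δ (x i)| ≤ 1 := abs_criticalCorr_le_one le_rfl _ _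
    have hδ1 : δ < 1 := hδ.2.trans_le (min_le_left _ _)
    have hδε : δ < ε := hδ.2.trans_le (min_le_right _ _)
    calc δ ^ n * |criticalCorr 3 n fun i => latticeApprox δ (x i)| ≤ δ ^ n * 1 :=
          mul_le_mul_of_nonneg_left h1 (pow_nonneg hδ.1.le n)
      _ ≤ δ ^ 1 * 1 := by
          refine mul_le_mul_of_nonneg_right (pow_le_pow_of_le_one hδ.1.le hδ1.le hn) zero_le_one
      _ < ε := by simpa using hδε

/-- The zero family has `U₄ ≡ 0`. -/
theorem not_hasNontrivialU4_zeroFamily : ¬ HasNontrivialU4 zeroFamily := by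
  rintro ⟨x, -, hne⟩
  exact hne (by simp [limitConnectedFour, zeroFamily])

/-- **§A.1 — non-degeneracy is load-bearing (unless K1 is false)**: with `IsNondegenerateTwoPoint`
dropped, the bridge is EQUIVALENT to `¬ IndependentStrandsJoin`. Witness `ρ δ = δ`, limit `≡ 0`.
Any proof of the bridge uses `S₂ > 0` (through the sign of `U₄/S₂S₂`, §C). [folklore] -/
theorem withoutNondegeneracy_iff_not_strandsJoin : CruxWithoutNondegeneracy ↔ ¬ StrandsJoin := by
  refine ⟨fun h hK => ?_, fun h hK => absurd hK h⟩
  exact not_hasNontrivialU4_zeroFamily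
    (h hK (fun δ => δ) zeroFamily (fun _ hδ => hδ.1) hasPointwiseScalingLimit_zeroFamily)

/-- The bridge with the LATTICE CLAUSE dropped (model-blind conclusion). -/
def CruxWithoutLimit : Prop :=
  StrandsJoin → ∀ S : CorrFamily 3, IsNondegenerateTwoPoint S → HasNontrivialU4 S

/-- The normalised Wick (Gaussian) family at orders 2 and 4: `S₂ ≡ 1`, `S₄ ≡ 3` (sum of the three
pairings), anything elsewhere. -/
def wickUnitFamily : CorrFamily 3 := fun n _ =>
  if n = 2 then 1 else if n = 4 then 3 else 0

/-- The unit Wick family is non-degenerate … -/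
theorem isNondegenerateTwoPoint_wickUnitFamily : IsNondegenerateTwoPoint wickUnitFamily :=
  fun _ _ => by simp [wickUnitFamily]

/-- … and has `U₄ ≡ 0`. -/
theorem not_hasNontrivialU4_wickUnitFamily : ¬ HasNontrivialU4 wickUnitFamily := by
  rintro ⟨x, -, hne⟩
  apply hne
  simp [limitConnectedFour, wickUnitFamily]
  norm_num

/-- **§A.2 — the lattice clause is load-bearing (unless K1 is false)**: with
`HasPointwiseScalingLimit (criticalCorr 3) ρ S` dropped, the bridge is EQUIVALENT to
`¬ IndependentStrandsJoin` (witness: the unit Wick family). Non-triviality is not a consequence of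
non-degeneracy (nor of any covariance list, cf. the GFF in `Cruxes/IsingEuclidUpgradeR4NonGaussian`). [folklore] -/
theorem withoutLimit_iff_not_strandsJoin : CruxWithoutLimit ↔ ¬ StrandsJoin := by
  refine ⟨fun h hK => ?_, fun h hK => absurd hK h⟩
  exact not_hasNontrivialU4_wickUnitFamily (h hK wickUnitFamily isNondegenerateTwoPoint_wickUnitFamily)

/-- The bridge with NO condition on the renormalisation `ρ`. -/
def CruxWithoutPositivity : Prop :=
  StrandsJoin → ∀ (ρ : ℝ → ℝ) (S : CorrFamily 3),
    HasPointwiseScalingLimit (criticalCorr 3) ρ S → IsNondegenerateTwoPoint S → HasNontrivialU4 S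

/-- A reference non-coincident pair `(0, e₀)`. -/
theorem refPair_mem : (![0, EuclideanSpace.single (0 : Fin 3) (1:ℝ)] : Fin 2 → EuclideanSpace ℝ (Fin 3))
    ∈ NonCoincident 3 2 := by
  refine pair_mem_nonCoincident fun h => ?_
  have := congrArg (fun v : EuclideanSpace ℝ (Fin 3) => v 0) h
  simp at this

/-- A limit with `S₂ > 0` at one pair forces `ρ δ ≠ 0` for all small `δ`. [folklore] -/
theorem eventually_ne_zero_of_limit {ρ : ℝ → ℝ} {S : CorrFamily 3}
    (hlim : HasPointwiseScalingLimit (criticalCorr 3) ρ S) (hnd : IsNondegenerateTwoPoint S) :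
    ∀ᶠ δ in 𝓝[>] (0:ℝ), ρ δ ≠ 0 := by
  have h := ((hlim 2).tendsto_at refPair_mem).eventually_const_lt (hnd _ refPair_mem)
  filter_upwards [h] with δ hδ h0
  rw [rescaledCorrelator_apply, h0] at hδ
  norm_num at hδ

/-- **§A.3 — positivity of `ρ` is COSMETIC**: `Crux ↔ CruxWithoutPositivity`. (Odd critical
correlators vanish since `m*(β_c) = 0` — `criticalCorr_eq_zero_of_odd` — so `|ρ|` has the same limit as
`ρ`, and `ρ ≠ 0` eventually by non-degeneracy; `HasPointwiseScalingLimit.exists_pos_renormalisation`.)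
The hypothesis `hρ` may be ignored by the prover. [folklore] -/
theorem iff_withoutPositivity : Crux ↔ CruxWithoutPositivity := by
  refine ⟨fun h hK ρ S hlim hnd => ?_, fun h hK ρ S _ hlim hnd => h hK ρ S hlim hnd⟩
  obtain ⟨ρ', hρ', hlim'⟩ := hlim.exists_pos_renormalisation
    (fun n hn y => criticalCorr_eq_zero_of_odd le_rfl hn y) (eventually_ne_zero_of_limit hlim hnd)
  exact h hK ρ' S (fun δ _ => hρ' δ) hlim' hnd

/-- The bridge with its ANTECEDENT dropped is item 0636 (open; attacked by its own disprover). -/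
theorem withoutStrandsJoin_iff_item0636 :
    (∀ (ρ : ℝ → ℝ) (S : CorrFamily 3), (∀ δ ∈ Set.Ioc (0:ℝ) 1, 0 < ρ δ) →
      HasPointwiseScalingLimit (criticalCorr 3) ρ S → IsNondegenerateTwoPoint S → HasNontrivialU4 S) ↔
    Summit.CriticalPhenomena.Ising3DConformalLimit.Theses.IsingEuclidUpgrade.IsingEuclidUpgradeR4NonGaussian :=
  Iff.rfl

/-- **§A.4 — given K1, the bridge IS item 0636** (so staffing it with a prover before K1 is settled buys
exactly the support chain of §B, nothing about 0636 itself). -/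
theorem crux_iff_item0636_of_strandsJoin (hK : StrandsJoin) : Crux ↔ Conclusion :=
  ⟨fun h => h hK, fun h _ => h⟩


/-! ## §B Why it resists — the support chain, kernel-checked

`JoinForcesU4` is the composite StrandsJoinBound ∘ LatticeBoundFromStrands ∘ FarMergingGivesU4 (planner's
`joinForcesU4_of`, Sketch.lean). The third factor is proved outright here; so a refutation of the bridge
refutes one of the two remaining provable-now supports. -/

/-- The tetrahedral shape of the route. -/
abbrev tetra : Fin 4 → Site 3 := ![![-1, -1, -1], ![1, 1, -1], ![1, -1, 1], ![-1, 1, 1]]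

/-- The tetrahedral shape is injective. -/
theorem tetra_injective : Function.Injective tetra := by decide

/-- At mesh `1/L` the lattice approximation of an integer point (cast to `ℝ³`) is EXACT: `[x/(1/L)] = L•x`.
This is why `FarMergingGivesU4` needs no continuity of `S`. [folklore] -/
theorem latticeApprox_inv_natCast_siteVec {d : ℕ} (L : ℕ) (u : Site d) :
    latticeApprox ((L : ℝ)⁻¹) (siteVec u) = (L : ℤ) • u := by
  funext k
  simp only [latticeApprox_apply, siteVec_apply, Pi.smul_apply, smul_eq_mul, div_inv_eq_mul]
  rw [show (u k : ℝ) * (L : ℝ) = (((L : ℤ) * u k : ℤ) : ℝ) by push_cast; ring, Int.floor_intCast]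

/-- Integer points cast to `ℝ³` injectively. [folklore] -/
theorem siteVec_injective {d : ℕ} : Function.Injective (siteVec : Site d → EuclideanSpace ℝ (Fin d)) := by
  intro u v h
  funext k
  have := congrArg (fun w : EuclideanSpace ℝ (Fin d) => w k) h
  simp only [siteVec_apply] at this
  exact_mod_cast this

/-- The arithmetic step `U ≤ -c·G·G ⟹ c·(r²G)(r²G) ≤ -(r⁴U)` (multiply by `r⁴ ≥ 0`). -/
theorem arith_step {c r G₁ G₂ U : ℝ} (h : U ≤ -(c * (G₁ * G₂))) :
    c * (r ^ 2 * G₁ * (r ^ 2 * G₂)) ≤ -(r ^ 4 * U) := by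
  have h4 : (0:ℝ) ≤ r ^ 4 := by positivity
  nlinarith [mul_le_mul_of_nonneg_left h h4]

/-- The hypothesis of item 4471 in dimension `d`: FAR MERGING — `U₄^crit(L•x) ≤ -c⟨σσ⟩⟨σσ⟩(L•x)` along
infinitely many dilations `L` of a fixed injective lattice shape `x : Fin 4 → ℤ^d` (verbatim the
antecedent of `FarMergingGivesU4` with `3 ↦ d`). -/
def FarMergingAt (d : ℕ) : Prop :=
  ∃ c : ℝ, 0 < c ∧ ∃ x : Fin 4 → Site d, Function.Injective x ∧ ∀ L₀ : ℕ, ∃ L : ℕ, L₀ ≤ L ∧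
    criticalCorr d 4 (fun i => (L : ℤ) • x i) - (criticalCorr d 2 ![(L : ℤ) • x 0, (L : ℤ) • x 1] *
      criticalCorr d 2 ![(L : ℤ) • x 2, (L : ℤ) • x 3] + criticalCorr d 2 ![(L : ℤ) • x 0, (L : ℤ) • x 2] *
      criticalCorr d 2 ![(L : ℤ) • x 1, (L : ℤ) • x 3] + criticalCorr d 2 ![(L : ℤ) • x 0, (L : ℤ) • x 3] *
      criticalCorr d 2 ![(L : ℤ) • x 1, (L : ℤ) • x 2]) ≤
      -(c * (criticalCorr d 2 ![(L : ℤ) • x 0, (L : ℤ) • x 1] * criticalCorr d 2 ![(L : ℤ) • x 2, (L : ℤ) • x 3]))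

/-- **§B.1 — far merging forces `U₄^S ≢ 0`, in EVERY dimension `d`** (the proof of item 4471 is
dimension-free; no sign or size condition on `ρ` is used, only `ρ⁴ ≥ 0`): choose `L_k ≥ k+1` with the
lattice inequality, mesh `δ_k = 1/L_k → 0⁺`, use EXACTNESS of the lattice approximation at integer points
(`latticeApprox_inv_natCast_siteVec`, so no continuity of `S` is needed), multiply by `ρ(δ_k)⁴ ≥ 0` and
pass to the limit with `tendsto_rescaled_criticalUrsellFour`; then `U₄^S(x) ≤ -c S₂S₂ < 0` by
non-degeneracy. [cite: AizenmanDuminilCopinAnnals2021, §1 eq. (1.21) and §3.2 eq. (3.11)] -/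
theorem farMerging_gives_U4 (d : ℕ) (h : FarMergingAt d) :
    ∀ (ρ : ℝ → ℝ) (S : CorrFamily d),
      HasPointwiseScalingLimit (criticalCorr d) ρ S → IsNondegenerateTwoPoint S → HasNontrivialU4 S := by
  rintro ρ S hlim hnd
  obtain ⟨c, hc, x, hx, hL⟩ := h
  choose L hL₀ hineq using hL
  have hLpos : ∀ k, 0 < L (k + 1) := fun k => Nat.lt_of_lt_of_le (Nat.succ_pos k) (hL₀ (k + 1))
  -- the continuum copy of the shape is non-coincident
  have hy : (fun i => siteVec (x i) : Fin 4 → EuclideanSpace ℝ (Fin d)) ∈ NonCoincident d 4 :=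
    fun i j hij => hx (siteVec_injective hij)
  -- the mesh sequence `δ_k = 1/L_{k+1} → 0⁺`
  have hu : Tendsto (fun k : ℕ => ((L (k + 1) : ℕ) : ℝ)⁻¹) atTop (𝓝[>] (0:ℝ)) := by
    refine tendsto_nhdsWithin_iff.2 ⟨?_, Filter.Eventually.of_forall fun k => ?_⟩
    · have h1 : Tendsto (fun k : ℕ => ((L (k + 1) : ℕ) : ℝ)) atTop atTop :=
        tendsto_natCast_atTop_atTop.comp
          (tendsto_atTop_mono (fun k => hL₀ (k + 1)) (tendsto_add_atTop_nat 1))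
      exact h1.inv_tendsto_atTop
    · exact Set.mem_Ioi.2 (inv_pos.2 (Nat.cast_pos.2 (hLpos k)))
  have happrox : ∀ (k : ℕ) (i : Fin 4),
      latticeApprox (((L (k + 1) : ℕ) : ℝ)⁻¹) (siteVec (x i)) = ((L (k + 1) : ℕ) : ℤ) • x i :=
    fun k i => latticeApprox_inv_natCast_siteVec (L (k + 1)) (x i)
  -- convergence of the rescaled lattice `U₄` and of the pair products along the sequence
  have hU := (tendsto_rescaled_criticalUrsellFour hlim hy).comp hu
  have hpair : ∀ i j, i ≠ j → Tendsto
      (fun δ => ρ δ ^ 2 * criticalCorr d 2 ![latticeApprox δ (siteVec (x i)), latticeApprox δ (siteVec (x j))])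
      (𝓝[>] 0) (𝓝 (S 2 ![siteVec (x i), siteVec (x j)])) := by
    intro i j hij
    have hmem : (![siteVec (x i), siteVec (x j)] : Fin 2 → EuclideanSpace ℝ (Fin d)) ∈ NonCoincident d 2 :=
      pair_mem_nonCoincident fun h => hij (hx (siteVec_injective h))
    refine Tendsto.congr (fun δ => ?_) ((hlim 2).tendsto_at hmem)
    rw [rescaledCorrelator_apply, latticeApprox_comp_two]
    rfl
  have hB := ((((hpair 0 1 (by decide)).mul (hpair 2 3 (by decide))).const_mul c)).comp hu
  -- the lattice inequality passes to the limit
  have hle : c * (S 2 ![siteVec (x 0), siteVec (x 1)] * S 2 ![siteVec (x 2), siteVec (x 3)]) ≤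
      - limitConnectedFour S (fun i => siteVec (x i)) := by
    refine le_of_tendsto_of_tendsto hB hU.neg (Filter.Eventually.of_forall fun k => ?_)
    simp only [Function.comp_apply, happrox]
    exact arith_step (hineq (k + 1))
  have h01 : (![siteVec (x 0), siteVec (x 1)] : Fin 2 → EuclideanSpace ℝ (Fin d)) ∈ NonCoincident d 2 :=
    pair_mem_nonCoincident fun h => absurd (hx (siteVec_injective h)) (by decide)
  have h23 : (![siteVec (x 2), siteVec (x 3)] : Fin 2 → EuclideanSpace ℝ (Fin d)) ∈ NonCoincident d 2 :=
    pair_mem_nonCoincident fun h => absurd (hx (siteVec_injective h)) (by decide)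
  have hpos : 0 < c * (S 2 ![siteVec (x 0), siteVec (x 1)] * S 2 ![siteVec (x 2), siteVec (x 3)]) :=
    mul_pos hc (mul_pos (hnd _ h01) (hnd _ h23))
  exact ⟨_, hy, (by linarith : limitConnectedFour S (fun i => siteVec (x i)) < 0).ne⟩

/-- **§B.1′ — item 4471 `FarMergingGivesU4` PROVED** (support of this route and of EnergyNotSigmaSquared,
"provable now"; the third factor of the bridge): the `d = 3` instance of `farMerging_gives_U4` (the
positivity hypothesis on `ρ` is not even used). Candidate proof attached to item 4471 for a prover to
land. [cite: AizenmanDuminilCopinAnnals2021, §1 eq. (1.21) and §3.2 eq. (3.11)] -/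
theorem farMergingGivesU4_holds : FarMergingGivesU4 :=
  fun h ρ S _ hlim hnd => farMerging_gives_U4 3 h ρ S hlim hnd

/-- Read-back: the antecedent of `FarMergingGivesU4` is `FarMergingAt 3` (definitional). -/
theorem farMergingGivesU4_iff : FarMergingGivesU4 ↔ (FarMergingAt 3 → ∀ (ρ : ℝ → ℝ) (S : CorrFamily 3),
    (∀ δ ∈ Set.Ioc (0:ℝ) 1, 0 < ρ δ) → HasPointwiseScalingLimit (criticalCorr 3) ρ S →
    IsNondegenerateTwoPoint S → HasNontrivialU4 S) :=
  Iff.rfl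

/-- The conclusion of `LatticeBoundFromStrands` (the tetrahedral lattice bound, `ρ`-free): by itself it
already yields the conclusion of the crux (item 4471 at `x = tetra`, `L = max L₀ 1`). -/
def TetraLatticeBound : Prop :=
  ∃ c : ℝ, 0 < c ∧ ∀ l : ℕ, 1 ≤ l → criticalCorr 3 4 (fun i => (l : ℤ) • tetra i) - (criticalCorr 3 2 ![(l : ℤ) • tetra 0, (l : ℤ) • tetra 1] * criticalCorr 3 2 ![(l : ℤ) • tetra 2, (l : ℤ) • tetra 3] + criticalCorr 3 2 ![(l : ℤ) • tetra 0, (l : ℤ) • tetra 2] * criticalCorr 3 2 ![(l : ℤ) • tetra 1, (l : ℤ) • tetra 3] + criticalCorr 3 2 ![(l : ℤ) • tetra 0, (l : ℤ) • tetra 3] * criticalCorr 3 2 ![(l : ℤ) • tetra 1, (l : ℤ) • tetra 2]) ≤ -(c * (criticalCorr 3 2 ![(l : ℤ) • tetra 0, (l : ℤ) • tetra 1] * criticalCorr 3 2 ![(l : ℤ) • tetra 2, (l : ℤ) • tetra 3]))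

/-- Read-back: the glue `LatticeBoundFromStrands` is `K1 → StrandsJoinBound → TetraLatticeBound`
(definitional, the route's `let tetra := …` zeta-reduces to the abbrev `tetra`). -/
theorem latticeBoundFromStrands_iff :
    LatticeBoundFromStrands ↔ (StrandsJoin → StrandsJoinBound → TetraLatticeBound) := Iff.rfl

/-- **§B.2 — the tetrahedral lattice bound alone gives the conclusion** (for every non-degenerate
pointwise limit, any `ρ > 0`). -/
theorem conclusion_of_tetraLatticeBound (h : TetraLatticeBound) : Conclusion := by
  intro ρ S hρ hlim hnd
  obtain ⟨c, hc, hl⟩ := h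
  exact farMergingGivesU4_holds ⟨c, hc, tetra, tetra_injective, fun L₀ =>
    ⟨max L₀ 1, le_max_left _ _, hl _ (le_max_right _ _)⟩⟩ ρ S hρ hlim hnd

/-- **§B.3 — the bridge from its two remaining supports** (the planner's `joinForcesU4_of` with item
4471 discharged): `StrandsJoinBound → LatticeBoundFromStrands → JoinForcesU4`. -/
theorem crux_of_supports (h₁ : StrandsJoinBound) (h₂ : LatticeBoundFromStrands) : Crux := by
  intro hK
  have h := h₂ hK h₁
  exact conclusion_of_tetraLatticeBound h

/-- **§B.4 — what a refutation of the bridge would break**: one of two dimension-free, provable-now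
supports — the finite-graph Aizenman-type inequality `StrandsJoinBound` (`U₄·Z⁰² ≤ −2·ΣΣ t^{|F₁|+|F₂|}
1[a₀↔a₂ in F₁∪F₂]`, exact-checked on K4, C4, Q3, 3×3 grid, H-graph, 3×2×2 slab at five temperatures:
evidence `strands_join_check.txt` on the item) or the box → `ℤ³` glue `LatticeBoundFromStrands`. -/
theorem not_crux_imp_not_support (h : ¬ Crux) : ¬ StrandsJoinBound ∨ ¬ LatticeBoundFromStrands := by
  by_cases h₁ : StrandsJoinBound
  · exact Or.inr fun h₂ => h (crux_of_supports h₁ h₂)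
  · exact Or.inl h₁

/-- **§B.5 — given K1, refuting the bridge refutes the glue chain AND item 0636 at once.** -/
theorem not_crux_iff_of_strandsJoin (hK : StrandsJoin) : ¬ Crux ↔ ¬ Conclusion :=
  not_congr (crux_iff_item0636_of_strandsJoin hK)


/-
§B.6 (comment) INDEPENDENT EXACT CHECK of the support `StrandsJoinBound` with the Lean semantics (free Ising
weight ∏_edges (1 + t σσ'), t = tanh β; tJoins = edge sets with prescribed odd-degree set; Z⁰ = Σ_even t^|F|;
reachability in F₁ ∪ F₂), in exact rational arithmetic (folder `exact_check.py`, output `exact_check_output.txt`,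
attached as item evidence): graphs K4, C4 (pairs = diagonals), C4 (pairs = adjacent), P4, K4 + pendant path,
W5 (double cone), 2×3 grid × t ∈ {1/5, 2181/10⁴ ≈ t_c, 1/2, 9/10, 10⁻³}: 35/35 satisfy
U₄·Z⁰² ≤ −2·ΣΣ (strict on K4, C4-adjacent, K4+path, W5; equality where a₀ ↔ a₂ is forced), the sandwich
ℓ⊗ℓ[a₀↔a₂ in F₁∪F₂] ≤ P⊗P[a₀↔a₂ in n₁+n₂] = −U₄/(2⟨σσ⟩⟨σσ⟩) ≤ 1, and the HT identity ⟨σ₀σ₁⟩ = Z^{01}/Z⁰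
exactly. (Corroborates the one-shot refuter's 30/30 floating-point check on 6 other graphs.) Example of what K1
gives away relative to clause (iii): C4-adjacent at t = 1/2 has ℓ⊗ℓ[join] = 0.36 < P⊗P[join] = 0.64.
-/

/-! ## §C Strengthenings and variants of the conclusion the chain actually delivers -/

/-- Exactness of the lattice approximation at a DILATED integer point with the matched mesh:
`[s•u / (s/l)] = l•u` (`s ≠ 0`, `l ≠ 0`). [folklore] -/
theorem latticeApprox_dilate_siteVec {d : ℕ} {s : ℝ} (hs : s ≠ 0) {l : ℕ} (hl : l ≠ 0) (u : Site d) :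
    latticeApprox (s / l) (s • siteVec u) = (l : ℤ) • u := by
  funext k
  simp only [latticeApprox_apply, PiLp.smul_apply, siteVec_apply, smul_eq_mul, Pi.smul_apply]
  have hl' : (l : ℝ) ≠ 0 := Nat.cast_ne_zero.2 hl
  rw [show s * (u k : ℝ) / (s / (l : ℝ)) = (((l : ℤ) * u k : ℤ) : ℝ) by
    push_cast
    field_simp, Int.floor_intCast]

/-- **§C.1 — the tetrahedral lattice bound gives `U₄^S < 0` on the WHOLE ray of regular tetrahedra**
`s•A`, `s > 0`, with the uniform ratio `-U₄^S(s•A) ≥ c·S₂(s a₀, s a₁)·S₂(s a₂, s a₃)` — for every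
non-degenerate pointwise limit `S`, any `ρ`, NO scale covariance assumed (mesh `δ_l = s/l`, exact lattice
approximation `latticeApprox_dilate_siteVec`). This is the strongest conclusion the route's chain yields
from K1; it is still far from `U₄ ≢ 0` being USED anywhere else (clause (iii) only asks `∃ x, U₄ x ≠ 0`). -/
theorem ray_bound_of_tetraLatticeBound (h : TetraLatticeBound) :
    ∃ c : ℝ, 0 < c ∧ ∀ (ρ : ℝ → ℝ) (S : CorrFamily 3),
      HasPointwiseScalingLimit (criticalCorr 3) ρ S → IsNondegenerateTwoPoint S → ∀ s : ℝ, 0 < s →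
        limitConnectedFour S (fun i => s • siteVec (tetra i)) ≤
          -(c * (S 2 ![s • siteVec (tetra 0), s • siteVec (tetra 1)] *
            S 2 ![s • siteVec (tetra 2), s • siteVec (tetra 3)])) ∧
        limitConnectedFour S (fun i => s • siteVec (tetra i)) < 0 := by
  obtain ⟨c, hc, hl⟩ := h
  refine ⟨c, hc, fun ρ S hlim hnd s hs => ?_⟩
  have hsi : Function.Injective (fun i : Fin 4 => s • siteVec (tetra i) : Fin 4 → EuclideanSpace ℝ (Fin 3)) :=
    fun i j hij => tetra_injective (siteVec_injective (smul_right_injective _ hs.ne' hij))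
  have hy : (fun i => s • siteVec (tetra i) : Fin 4 → EuclideanSpace ℝ (Fin 3)) ∈ NonCoincident 3 4 := hsi
  -- mesh `δ_l = s/(l+1) → 0⁺`
  have hu : Tendsto (fun l : ℕ => s / ((l + 1 : ℕ) : ℝ)) atTop (𝓝[>] (0:ℝ)) := by
    refine tendsto_nhdsWithin_iff.2 ⟨?_, Filter.Eventually.of_forall fun l => ?_⟩
    · exact tendsto_const_nhds.div_atTop
        (tendsto_natCast_atTop_atTop.comp (tendsto_add_atTop_nat 1))
    · exact Set.mem_Ioi.2 (div_pos hs (Nat.cast_pos.2 (Nat.succ_pos l)))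
  have happrox : ∀ (l : ℕ) (i : Fin 4),
      latticeApprox (s / ((l + 1 : ℕ) : ℝ)) (s • siteVec (tetra i)) = ((l + 1 : ℕ) : ℤ) • tetra i :=
    fun l i => latticeApprox_dilate_siteVec hs.ne' (Nat.succ_ne_zero l) (tetra i)
  have hU := (tendsto_rescaled_criticalUrsellFour hlim hy).comp hu
  have hpair : ∀ i j, i ≠ j → Tendsto
      (fun δ => ρ δ ^ 2 * criticalCorr 3 2 ![latticeApprox δ (s • siteVec (tetra i)),
        latticeApprox δ (s • siteVec (tetra j))])
      (𝓝[>] 0) (𝓝 (S 2 ![s • siteVec (tetra i), s • siteVec (tetra j)])) := by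
    intro i j hij
    have hmem : (![s • siteVec (tetra i), s • siteVec (tetra j)] : Fin 2 → EuclideanSpace ℝ (Fin 3)) ∈
        NonCoincident 3 2 :=
      pair_mem_nonCoincident fun h => hij (hsi h)
    refine Tendsto.congr (fun δ => ?_) ((hlim 2).tendsto_at hmem)
    rw [rescaledCorrelator_apply, latticeApprox_comp_two]
    rfl
  have hB := ((((hpair 0 1 (by decide)).mul (hpair 2 3 (by decide))).const_mul c)).comp hu
  have hle : c * (S 2 ![s • siteVec (tetra 0), s • siteVec (tetra 1)] *
      S 2 ![s • siteVec (tetra 2), s • siteVec (tetra 3)]) ≤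
      - limitConnectedFour S (fun i => s • siteVec (tetra i)) := by
    refine le_of_tendsto_of_tendsto hB hU.neg (Filter.Eventually.of_forall fun l => ?_)
    simp only [Function.comp_apply, happrox]
    exact arith_step (hl (l + 1) (Nat.succ_pos l))
  have h01 : (![s • siteVec (tetra 0), s • siteVec (tetra 1)] : Fin 2 → EuclideanSpace ℝ (Fin 3)) ∈
      NonCoincident 3 2 := pair_mem_nonCoincident fun h => absurd (hsi h) (by decide)
  have h23 : (![s • siteVec (tetra 2), s • siteVec (tetra 3)] : Fin 2 → EuclideanSpace ℝ (Fin 3)) ∈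
      NonCoincident 3 2 := pair_mem_nonCoincident fun h => absurd (hsi h) (by decide)
  have hpos : 0 < c * (S 2 ![s • siteVec (tetra 0), s • siteVec (tetra 1)] *
      S 2 ![s • siteVec (tetra 2), s • siteVec (tetra 3)]) :=
    mul_pos hc (mul_pos (hnd _ h01) (hnd _ h23))
  exact ⟨by linarith, by linarith⟩

/-- **§C.2 — given K1 and the two supports, the ray bound holds** (what the rev-4 spine REALLY proves
about the limit, beyond clause (iii)). -/
theorem ray_bound_of_supports (h₁ : StrandsJoinBound) (h₂ : LatticeBoundFromStrands) (hK : StrandsJoin) :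
    ∃ c : ℝ, 0 < c ∧ ∀ (ρ : ℝ → ℝ) (S : CorrFamily 3),
      HasPointwiseScalingLimit (criticalCorr 3) ρ S → IsNondegenerateTwoPoint S → ∀ s : ℝ, 0 < s →
        limitConnectedFour S (fun i => s • siteVec (tetra i)) ≤
          -(c * (S 2 ![s • siteVec (tetra 0), s • siteVec (tetra 1)] *
            S 2 ![s • siteVec (tetra 2), s • siteVec (tetra 3)])) ∧
        limitConnectedFour S (fun i => s • siteVec (tetra i)) < 0 :=
  ray_bound_of_tetraLatticeBound (h₂ hK h₁)

/-- The tetrahedral lattice bound INFINITELY OFTEN in the scale (limsup form of what K1 buys). -/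
def TetraLatticeBoundIO : Prop :=
  ∃ c : ℝ, 0 < c ∧ ∀ l₀ : ℕ, ∃ l : ℕ, l₀ ≤ l ∧ criticalCorr 3 4 (fun i => (l : ℤ) • tetra i) - (criticalCorr 3 2 ![(l : ℤ) • tetra 0, (l : ℤ) • tetra 1] * criticalCorr 3 2 ![(l : ℤ) • tetra 2, (l : ℤ) • tetra 3] + criticalCorr 3 2 ![(l : ℤ) • tetra 0, (l : ℤ) • tetra 2] * criticalCorr 3 2 ![(l : ℤ) • tetra 1, (l : ℤ) • tetra 3] + criticalCorr 3 2 ![(l : ℤ) • tetra 0, (l : ℤ) • tetra 3] * criticalCorr 3 2 ![(l : ℤ) • tetra 1, (l : ℤ) • tetra 2]) ≤ -(c * (criticalCorr 3 2 ![(l : ℤ) • tetra 0, (l : ℤ) • tetra 1] * criticalCorr 3 2 ![(l : ℤ) • tetra 2, (l : ℤ) • tetra 3]))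

/-- The `∀ l ≥ 1` form implies the infinitely-often form. -/
theorem tetraLatticeBoundIO_of (h : TetraLatticeBound) : TetraLatticeBoundIO := by
  obtain ⟨c, hc, hl⟩ := h
  exact ⟨c, hc, fun l₀ => ⟨max l₀ 1, le_max_left _ _, hl _ (le_max_right _ _)⟩⟩

/-- **§C.3 — K1 is STRONGER than the spine needs (planner note).** The conclusion already follows from
the tetrahedral lattice bound along SOME sequence of scales `l_k → ∞` (limsup form): item 4471 only ever
uses infinitely many dilations, and the glue `LatticeBoundFromStrands` is scale-by-scale (for each `l`,
`N → ∞`). Hence the rank-2 crux may be weakened to "K1 infinitely often in `l`"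
(`∃ c > 0, ∀ l₀, ∃ l ≥ l₀, ∃ N₀, ∀ N ≥ N₀, …`) keeping the deciding theorem's SHAPE (K1-IO → bridge-IO →
MoebiusLimit → conjunct; the glue restated scale-by-scale); correspondingly a REFUTER of K1-as-needed must
show `ℓ⊗ℓ[a₀ ↔ a₂] → 0` along ALL scales, not along a subsequence. -/
theorem conclusion_of_tetraLatticeBoundIO (h : TetraLatticeBoundIO) : Conclusion := by
  intro ρ S _ hlim hnd
  obtain ⟨c, hc, hl⟩ := h
  exact farMerging_gives_U4 3 ⟨c, hc, tetra, tetra_injective, hl⟩ ρ S hlim hnd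

/-! ### §C.4 A natural strengthening REFUTED in Lean: `StrandsJoinBound` for a free edge weight `t`

The ideator card `iterated-oddpart-pushforward` (round 1) found by exact enumeration that the loop-dressed
Aizenman inequality is not a polynomial inequality in `t` (fails for `t > √2` on C4) and offered it to this
seat as a tightness lemma; here it is kernel-checked (`decide` over `ℕ`-valued loop sums on `cycleGraph 4`,
no extra axioms). Consequence for provers: the comparison step of any currents-free / XOR proof of
`StrandsJoinBound` must use `t ≤ 1` (as card `xor-coordinates` does: `PerUComparison` for `0 ≤ s ≤ 1`). -/

/-- The currents-free "all-t" strengthening of `StrandsJoinBound`: through the high-temperature expansion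
`⟨σ_S⟩^free_G = Z^S_t / Z⁰_t` (`t = tanh β`, `Z^S_t = loopO1PartitionFunction G t S`) the support
`StrandsJoinBound` reads `Z^Q Z⁰ − (Z^{01}Z^{23} + Z^{02}Z^{13} + Z^{03}Z^{12}) ≤ −2·JointSum_t` at
`t = tanh β ∈ [0,1)`; the strengthening asks the same polynomial inequality for EVERY weight `t ≥ 0`. -/
def LoopAizenmanAllT : Prop :=
  ∀ (V : Type) [Fintype V] [DecidableEq V] (G : SimpleGraph V) [DecidableRel G.Adj] (t : ℝ), 0 ≤ t →
    ∀ a : Fin 4 → V, Function.Injective a →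
      loopO1PartitionFunction G t {a 0, a 1, a 2, a 3} * loopO1PartitionFunction G t ∅ -
        (loopO1PartitionFunction G t {a 0, a 1} * loopO1PartitionFunction G t {a 2, a 3} +
         loopO1PartitionFunction G t {a 0, a 2} * loopO1PartitionFunction G t {a 1, a 3} +
         loopO1PartitionFunction G t {a 0, a 3} * loopO1PartitionFunction G t {a 1, a 2}) ≤
      -(2 * ∑ F₁ ∈ tJoins G Set.univ {a 0, a 1}, ∑ F₂ ∈ tJoins G Set.univ {a 2, a 3},
          open scoped Classical in
          if (SimpleGraph.fromEdgeSet ((↑F₁ : Set (Sym2 V)) ∪ ↑F₂)).Reachable (a 0) (a 2)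
          then t ^ (F₁.card + F₂.card) else 0)

/-- The 4-cycle `0–1–2–3–0` (pairs `{0,1}`, `{2,3}` are EDGES). -/
abbrev C4 : SimpleGraph (Fin 4) := SimpleGraph.cycleGraph 4

theorem tJoins_univ_eq {V : Type*} [Fintype V] [DecidableEq V] (G : SimpleGraph V) [DecidableRel G.Adj]
    (A : Finset V) :
    tJoins G Set.univ A = G.edgeFinset.powerset.filter (fun F => oddDegVerts F = A) := by
  ext F
  rw [mem_tJoins_iff_oddDegVerts, Finset.mem_filter, Finset.mem_powerset]
  simp

/-- `Z^A_{C4}(2)` as a natural-number sum (kernel-computable). -/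
theorem loopZ_C4_two (A : Finset (Fin 4)) :
    loopO1PartitionFunction C4 2 A =
      (((C4.edgeFinset.powerset.filter (fun F => oddDegVerts F = A)).sum (fun F => 2 ^ F.card) : ℕ) : ℝ) := by
  rw [loopO1PartitionFunction]
  have h : ∀ F ∈ C4.edgeFinset.powerset, loopO1Weight C4 2 A F =
      if oddDegVerts F = A then (2:ℝ) ^ F.card else 0 := by
    intro F hF
    have hF' : F ⊆ C4.edgeFinset := Finset.mem_powerset.1 hF
    simp only [loopO1Weight, tJoins_univ_eq, Finset.mem_filter, Finset.mem_powerset, hF', true_and]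
  rw [Finset.sum_congr rfl h, ← Finset.sum_filter]
  push_cast
  rfl

theorem zQ : loopO1PartitionFunction C4 2 {0, 1, 2, 3} = 8 := by
  rw [loopZ_C4_two]; exact_mod_cast (by decide : ((C4.edgeFinset.powerset.filter
    (fun F => oddDegVerts F = ({0, 1, 2, 3} : Finset (Fin 4)))).sum (fun F => 2 ^ F.card) : ℕ) = 8)
theorem z0 : loopO1PartitionFunction C4 2 ∅ = 17 := by
  rw [loopZ_C4_two]; exact_mod_cast (by decide : ((C4.edgeFinset.powerset.filter
    (fun F => oddDegVerts F = (∅ : Finset (Fin 4)))).sum (fun F => 2 ^ F.card) : ℕ) = 17)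
theorem z01 : loopO1PartitionFunction C4 2 {0, 1} = 10 := by
  rw [loopZ_C4_two]; exact_mod_cast (by decide : ((C4.edgeFinset.powerset.filter
    (fun F => oddDegVerts F = ({0, 1} : Finset (Fin 4)))).sum (fun F => 2 ^ F.card) : ℕ) = 10)
theorem z23 : loopO1PartitionFunction C4 2 {2, 3} = 10 := by
  rw [loopZ_C4_two]; exact_mod_cast (by decide : ((C4.edgeFinset.powerset.filter
    (fun F => oddDegVerts F = ({2, 3} : Finset (Fin 4)))).sum (fun F => 2 ^ F.card) : ℕ) = 10)
theorem z02 : loopO1PartitionFunction C4 2 {0, 2} = 8 := by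
  rw [loopZ_C4_two]; exact_mod_cast (by decide : ((C4.edgeFinset.powerset.filter
    (fun F => oddDegVerts F = ({0, 2} : Finset (Fin 4)))).sum (fun F => 2 ^ F.card) : ℕ) = 8)
theorem z13 : loopO1PartitionFunction C4 2 {1, 3} = 8 := by
  rw [loopZ_C4_two]; exact_mod_cast (by decide : ((C4.edgeFinset.powerset.filter
    (fun F => oddDegVerts F = ({1, 3} : Finset (Fin 4)))).sum (fun F => 2 ^ F.card) : ℕ) = 8)
theorem z03 : loopO1PartitionFunction C4 2 {0, 3} = 10 := by
  rw [loopZ_C4_two]; exact_mod_cast (by decide : ((C4.edgeFinset.powerset.filter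
    (fun F => oddDegVerts F = ({0, 3} : Finset (Fin 4)))).sum (fun F => 2 ^ F.card) : ℕ) = 10)
theorem z12 : loopO1PartitionFunction C4 2 {1, 2} = 10 := by
  rw [loopZ_C4_two]; exact_mod_cast (by decide : ((C4.edgeFinset.powerset.filter
    (fun F => oddDegVerts F = ({1, 2} : Finset (Fin 4)))).sum (fun F => 2 ^ F.card) : ℕ) = 10)

/-- The `T`-joins of `{0,1}` in `C4`: the edge `01` and the long way round. -/
theorem tJoins01 : tJoins C4 Set.univ ({0, 1} : Finset (Fin 4)) =
    { {s(0, 1)}, {s(1, 2), s(2, 3), s(0, 3)} } := by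
  rw [tJoins_univ_eq]; decide

/-- The `T`-joins of `{2,3}` in `C4`. -/
theorem tJoins23 : tJoins C4 Set.univ ({2, 3} : Finset (Fin 4)) =
    { {s(2, 3)}, {s(1, 2), s(0, 1), s(0, 3)} } := by
  rw [tJoins_univ_eq]; decide

/-- Reachability is constant on classes of a function that is constant along edges. -/
theorem reachable_invariant {V : Type*} {G : SimpleGraph V} (f : V → Bool)
    (hf : ∀ u v, G.Adj u v → f u = f v) {u v : V} (h : G.Reachable u v) : f u = f v := by
  obtain ⟨p⟩ := h
  induction p with
  | nil => rfl
  | cons ha _ ih => exact (hf _ _ ha).trans ih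

/-- Adjacency in `fromEdgeSet` of a union of two explicit finsets, made decidable-friendly. -/
theorem fromEdgeSet_union_adj {V : Type*} (F₁ F₂ : Finset (Sym2 V)) (u v : V) :
    (SimpleGraph.fromEdgeSet ((↑F₁ : Set (Sym2 V)) ∪ ↑F₂)).Adj u v ↔ (s(u, v) ∈ F₁ ∨ s(u, v) ∈ F₂) ∧ u ≠ v := by
  rw [SimpleGraph.fromEdgeSet_adj, Set.mem_union, Finset.mem_coe, Finset.mem_coe]

/-- The joint sum on `C4` at `t = 2`: `2⁴ + 2⁴ + 2⁶ = 96` (the pair `({01},{23})` does not join `0` to `2`). -/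
theorem jointSum_C4_two :
    (∑ F₁ ∈ tJoins C4 Set.univ ({0, 1} : Finset (Fin 4)), ∑ F₂ ∈ tJoins C4 Set.univ ({2, 3} : Finset (Fin 4)),
      open scoped Classical in
      if (SimpleGraph.fromEdgeSet ((↑F₁ : Set (Sym2 (Fin 4))) ∪ ↑F₂)).Reachable 0 2
      then (2:ℝ) ^ (F₁.card + F₂.card) else 0) = 96 := by
  classical
  rw [tJoins01, tJoins23]
  rw [Finset.sum_pair (by decide), Finset.sum_pair (by decide), Finset.sum_pair (by decide)]
  -- the four reachability facts
  have hA : ¬ (SimpleGraph.fromEdgeSet ((↑({s(0, 1)} : Finset (Sym2 (Fin 4))) : Set (Sym2 (Fin 4))) ∪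
      ↑({s(2, 3)} : Finset (Sym2 (Fin 4))))).Reachable 0 2 := by
    intro h
    have := reachable_invariant (G := SimpleGraph.fromEdgeSet ((↑({s(0, 1)} : Finset (Sym2 (Fin 4))) :
      Set (Sym2 (Fin 4))) ∪ ↑({s(2, 3)} : Finset (Sym2 (Fin 4)))))
      (fun v : Fin 4 => decide (v = 0 ∨ v = 1)) (fun u v huv => ?_) h
    · revert this; decide
    · rw [fromEdgeSet_union_adj] at huv
      revert u v; decide
  have adj : ∀ (F₁ F₂ : Finset (Sym2 (Fin 4))) (u v : Fin 4), (s(u, v) ∈ F₁ ∨ s(u, v) ∈ F₂) → u ≠ v →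
      (SimpleGraph.fromEdgeSet ((↑F₁ : Set (Sym2 (Fin 4))) ∪ ↑F₂)).Reachable u v :=
    fun F₁ F₂ u v h hne => ((fromEdgeSet_union_adj F₁ F₂ u v).2 ⟨h, hne⟩).reachable
  have hB : (SimpleGraph.fromEdgeSet ((↑({s(0, 1)} : Finset (Sym2 (Fin 4))) : Set (Sym2 (Fin 4))) ∪
      ↑({s(1, 2), s(0, 1), s(0, 3)} : Finset (Sym2 (Fin 4))))).Reachable 0 2 :=
    (adj _ _ 0 1 (by decide) (by decide)).trans (adj _ _ 1 2 (by decide) (by decide))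
  have hC : (SimpleGraph.fromEdgeSet ((↑({s(1, 2), s(2, 3), s(0, 3)} : Finset (Sym2 (Fin 4))) :
      Set (Sym2 (Fin 4))) ∪ ↑({s(2, 3)} : Finset (Sym2 (Fin 4))))).Reachable 0 2 :=
    (adj _ _ 0 3 (by decide) (by decide)).trans (adj _ _ 3 2 (by decide) (by decide))
  have hD : (SimpleGraph.fromEdgeSet ((↑({s(1, 2), s(2, 3), s(0, 3)} : Finset (Sym2 (Fin 4))) :
      Set (Sym2 (Fin 4))) ∪ ↑({s(1, 2), s(0, 1), s(0, 3)} : Finset (Sym2 (Fin 4))))).Reachable 0 2 :=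
    (adj _ _ 0 3 (by decide) (by decide)).trans (adj _ _ 3 2 (by decide) (by decide))
  rw [if_neg hA, if_pos hB, if_pos hC, if_pos hD]
  simp only [Finset.card_singleton]
  rw [show ({s(1, 2), s(2, 3), s(0, 3)} : Finset (Sym2 (Fin 4))).card = 3 by decide,
    show ({s(1, 2), s(0, 1), s(0, 3)} : Finset (Sym2 (Fin 4))).card = 3 by decide]
  norm_num

/-- **The all-`t` strengthening is FALSE**: on the 4-cycle with the two pairs as edges, at `t = 2`,
`Z^Q Z⁰ − ΣZZ = 8·17 − (10·10 + 8·8 + 10·10) = −128 > −192 = −2·96`; in general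
`RHS − LHS = 2t⁴(2 − t²)` there, so the polynomial inequality fails for every `t > √2`. Hence
`tanh β ≤ 1` (the even dressing of currents) is LOAD-BEARING in `StrandsJoinBound`: no weight-preserving
`T`-join bijection / XOR argument valid for all `t` can prove it. -/
theorem not_loopAizenmanAllT : ¬ LoopAizenmanAllT := by
  intro h
  have h4 := h (Fin 4) C4 2 (by norm_num) (fun i => i) (fun _ _ e => e)
  rw [zQ, z0, z01, z23, z02, z13, z03, z12, jointSum_C4_two] at h4
  norm_num at h4

/-! ## §D Dimension sharpness of the chain (barrier `IsingTrivialityFromDimensionFour`) -/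

/-- **§D.1 — in `d ≥ 5` far merging along dilations is IMPOSSIBLE as soon as a non-degenerate pointwise
limit exists**: the tree theorem `limitConnectedFour_eq_zero_of_hasPointwiseScalingLimit_holds` (Aizenman
1982 / Fröhlich 1982: every such limit has `U₄ ≡ 0` off the diagonals) contradicts `farMerging_gives_U4`.
Since `StrandsJoinBound` is a dimension-free finite-graph inequality and the box → `ℤ^d` glue is
dimension-uniform, the `d`-dimensional analogue of the spine K1_d ⟹ FarMergingAt d can only fail at K1_d:
two independent critical HT strands on `ℤ^d`, `d ≥ 5`, do NOT meet with probability bounded below (modulo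
existence of the Gaussian limit) — the route's compliance with the barrier, as a theorem. A proof of K1 in
`d = 3` must therefore use `d < 4` somewhere (the route names the input: `2·D_HT > 3`).
[cite: AizenmanDuminilCopinAnnals2021, §1 p. 6 (U₄ = O(L^{4-d}) for d > 4)] -/
theorem not_farMergingAt_of_exists_limit {d : ℕ} (hd : 5 ≤ d)
    (hex : ∃ (ρ : ℝ → ℝ) (S : CorrFamily d), (∀ δ ∈ Set.Ioc (0:ℝ) 1, 0 < ρ δ) ∧
      HasPointwiseScalingLimit (criticalCorr d) ρ S ∧ IsNondegenerateTwoPoint S) :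
    ¬ FarMergingAt d := by
  intro hfm
  obtain ⟨ρ, S, hρ, hlim, hnd⟩ := hex
  obtain ⟨x, hx, hne⟩ := farMerging_gives_U4 d hfm ρ S hlim hnd
  exact hne (limitConnectedFour_eq_zero_of_hasPointwiseScalingLimit_holds hd ρ S hρ hlim hnd x hx)

/-- **§D.2 — … whereas in `d = 3` far merging at the tetrahedron is exactly what K1 buys**
(`TetraLatticeBound → FarMergingAt 3`). -/
theorem farMergingAt_three_of_tetraLatticeBound (h : TetraLatticeBound) : FarMergingAt 3 := by
  obtain ⟨c, hc, hl⟩ := h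
  exact ⟨c, hc, tetra, tetra_injective, fun L₀ => ⟨max L₀ 1, le_max_left _ _, hl _ (le_max_right _ _)⟩⟩

end Summit.CriticalPhenomena.Ising3DConformalLimit.Cruxes.JoinForcesU4.Disproof
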